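import Literature.MathematicalPhysics.QuantumFieldTheory.Balaban1983to89.B9Thm313WholeLeafCompletePairMBZ
import Literature.MathematicalPhysics.QuantumFieldTheory.Balaban1983to89.B9Thm313WholeBlocksPairMBCZ

/-!
# `Balaban1983to89.B9Thm313WholeLeafCompletePairMBCZ` — [B9] Theorem 3.13 (p. 426) AS THE WHOLE PRINTED LEAF `B9.Thm313Printed` AT THE PINS,
# PAIR-M FACE, β∕ε-INDEXED STEP SCHEMA, Z-CLASSED COARSE LETTERS, AND THE INPUT NORM LOCALISED ON CARRIER CLASSES — the R2-loc twin of
# `B9Thm313WholeLeafCompletePairMBZ.thm313Printed_completePairMBZ` (row 21's leaf of record after the located «INPUT-LOC CLASS≠FIBRE»)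

T. Bałaban, *Propagators for lattice gauge theories in a background field*, Commun. Math. Phys. **99** (1985) 389–434
[`Balaban1985BackgroundPropagators`, "B9"]; [4] = T. Bałaban, *Propagators and renormalization transformations for lattice
gauge theories. II*, Commun. Math. Phys. **96** (1984) 223–250 [`Balaban1984PropagatorsII`].  statement-level skeleton of published
theorems with citation tags; proofs where landed; nothing here is a claim about the Yang–Mills mass gap.

WHY (dag-n06-w3 g2 `B9Letters313IMBLocObstruction.hLIM_pins_false`; dag-n06-d g9 `B9BlockNormClassTransfer`; 2026-08-28): the sibling leaf's displayed
hypothesis `hLIM : … Letters313IMB …` is UNSATISFIABLE at the N06 pins (its field `locX` reads the input norm's block localisation on a fibre of the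
index-bond map instead of the carrier class).  This twin takes `hLIM : … Letters313IMBC … (Rel i) U` — the four (3.152)–(3.153) letters verbatim plus
the two TRUE class facts `vanishX ∕ leX` over the leaf's own class relation `Rel i` (multiplicity `m`, `hmult`; class-constant distance, `hRdist`) — and
is otherwise the sibling VERBATIM (`thm313Printed_of_stepRelZ`, `GG_l2Block_pairMZ`, `GG_holder_pairMBCZ`); the conclusion `B9.Thm313Printed …` is
byte-identical.  KNIT RECIPE (dag-n06-d): display `hLIM` at `Letters313IMBC … (RelB x.toKIdx) U` — or display the four letters and build it with
`B9Thm313WholeDirInputBC.letters313IMBC_of_IML` from `vanishX ∕ leX` proved at the pins — and call this leaf with the arguments of the sibling.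
HONEST SCOPE.  Bookkeeping over hypothesis schemas of printed shape; nothing of [B9] asserted; count-neutral; N06 NOT discharged; one finite lattice at a
time — nothing continuum ∕ ℝ⁴ ∕ OS ∕ mass gap ∕ Clay.  Cell `pub-ymgap` (HUMAN RULING D-0062), node N06 [B9], bundle F7 row 21, seat `pub-ymgap-dag-n06-l`
(g15), 2026-08-28.  NEW file; nothing landed is modified; 0 `def`.
-/

namespace Literature.MathematicalPhysics.QuantumFieldTheory.Balaban1983to89.B9Thm313WholeLeafCompletePairMBCZ

open Finset B6RandomWalk B6RandomWalkHom B9Thm34Ext B9Thm37GlueCor36 B11SectG B9SectDSup B9Thm37AllNorms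
open B9Thm37AllNormsInstances B9FromB6 B9FromB6ModelSignsOn B9SectBStepWhole B9Thm312Whole B9Thm312WholeLeaf B9Thm312WholeLeft B9Thm313Whole
open B9Thm313WholeLeft B9Thm312WholeLeafLeftGlob B9Ineq347CoReading B9SectCDiffDict B9CoRealizesRel B9Thm37Glue B9SectDL2Decay B9RWSums343Holder
open B9RWSumsReadsRel B9RWSumsReadsNbr B9Ineq347 B9Thm312WholeClasses B9Thm312WholeL2 B9Thm312WholeBlocksRel B9Thm312WholeBlocksNbr B9Thm313WholeLeafRel
open B9Thm312WholeHolder B9Thm312WholeHHolder B9Thm313WholeHolder B9Thm313WholeL2G B9Thm313WholeL2GP B9Thm313WholeInput B9Thm313WholeBlocksNbr B9Thm312WholeLeafAll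
open B9RWSums346SecondDiff B9Thm313WholeBlocksNbrRec B9RWSums344InputFam B9Thm312WholeDir B9Thm312WholeBlocksPairM B9Thm313WholeDir B9Thm313WholeDirInput B9Thm313WholeBlocksPairM
open B9Thm313WholeLeafCompletePairM B9Thm312WholeDirB B9Thm313WholeDirInputB B9Thm313WholeBlocksPairMB B9Thm313WholeLeafCompletePairMB B9Thm313WholeBlocksPairMZ B9Thm313WholeBlocksPairMBZ B9Thm313WholeLeafRelZ
open B9Thm313WholeLeafCompletePairMBZ B9Thm313WholeDirInputBC B9Thm313WholeBlocksPairMBCZ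
open B9Thm312WholeHZ B9Thm313WholeZ B9Thm313WholeLeftZ B9Thm313WholeHolderZ B9Thm313WholeInputZ B9Thm313WholeDirZ B9Thm313WholeDirInputZ B9Thm313WholeDirInputBZ
open B9Thm313WholeL2GZ B9Thm313WholeL2GPZ B9Thm313WholeDirL2Z

noncomputable section

section Family

variable {I : Type} {c35 : ℝ} {geo : I → B9.Geometry} {bg : I → B9.Backgrounds}
variable [∀ i, Fintype (geo i).Site] [∀ i, DecidableEq (geo i).Site]
variable {X Y Z W PX PY : I → Type} {P : Type} [∀ i, Fintype (X i)] [∀ i, DecidableEq (X i)] [∀ i, Fintype (Y i)]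
  [∀ i, Fintype (Z i)] [∀ i, Fintype (W i)] [∀ i, Fintype (PX i)] [∀ i, Fintype (PY i)] [Fintype P]

/-- Arithmetic of *"for α₀ sufficiently small"*: t ≧ 0 and m ≦ (2(t + 1))⁻¹ give tm ≦ ½. [folklore] -/
private theorem small_aux_mbz {t m : ℝ} (ht : 0 ≤ t) (hm : m ≤ (2 * (t + 1))⁻¹) : t * m ≤ 1 / 2 := by
  have hpos : 0 < 2 * (t + 1) := by linarith
  have h1 : t * m ≤ t * (2 * (t + 1))⁻¹ := mul_le_mul_of_nonneg_left hm ht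
  have h2 : t * (2 * (t + 1))⁻¹ ≤ 1 / 2 := by
    rw [← div_eq_mul_inv, div_le_iff₀ hpos]
    linarith
  linarith

-- heartbeat budget (v1.1): the one-block proof below elaborates at ≈ 160–190k heartbeats on the farm and above the 200k default
-- under `lake build` (pre-emptive: same shape as the three sibling leaves that failed the lane build 2026-08-27); statement and proof byte-identical to v1.
set_option maxHeartbeats 400000 in

/-- **R2-loc TWIN** (`hLIM : … → Letters313IMBC … (Rel i) U`: the input norm's localisation read on the classes of the leaf's own `Rel`; the Hölder
block through `GG_holder_pairMBCZ`; the uniform ε∕εβ constants carry the class multiplicity `m` on the `G₁∇\*`-sup-entry term; conclusion and everything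
else VERBATIM) of: **Z-TWIN (R1-cls LEAF OF RECORD FOR ROW 21)** of `B9Thm313WholeLeafCompletePairMB.thm313Printed_completePairMB`: binders `(wZ : ∀ i, 𝔅ᵢ → ℝ)`
`(hwZ : ∀ i y, 0 < wZ i y)` inserted before `hletters`; `hletters ↦ Letters313Z … (wZ i) (hwZ i)`, `hlettersD ↦ Letters313DZ ∧ Letters313DMZ`, `hLHH ↦ LettersHHZ …
(weightNorm (ofBlocks blkZ) (wZ i) …)`, `hLH3 ↦ Letters313HZ … (hgeo i) (wZ i) (hwZ i) …`, and `(vZ : ∀ i, 𝔅ᵢ → ℝ) (hvZ : …)` before `hLL2 ↦ Letters313L2PZ ∧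
Letters313L2MZ … (vZ i) (hvZ i)`; conclusion, pins, constants and every other binder VERBATIM;
proof verbatim over `thm313Printed_of_stepRelZ`, `GG_l2Block_pairMZ`, `GG_holder_pairMBZ`. ★★ **THEOREM 3.13 AS THE WHOLE PRINTED LEAF `B9.Thm313Printed`, AT THE PINS, PAIR-M FACE, WITH THE β∕ε-INDEXED STEP SCHEMA AND INPUT LETTERS**
(p. 426; the twin of `B9Thm313WholeLeafCompletePairM.thm313Printed_completePairM`).  Inputs: those of the PairM leaf VERBATIM except `hstepD : … → StepDirB …
(θ_D·Mα₀) (fun β => θ_H β·Mα₀) (fun ε => θ_I ε·Mα₀) δ_K U` and `hLIM : … → Letters313IMB … Br (fun ε => θ_V ε·Mα₀) Bd Bd2 δ₃ δ_K U` with θ_H θ_I θ_V Br :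
ℝ → ℝ (non-negative on [0,1) resp. (0,∞)).  PROVED INSIDE: every member, as in the PairM leaf — the Hölder block by
`B9Thm313WholeBlocksPairMB.GG_holder_pairMB` with the uniformising letters t_H(β) = θ_H(β)a₁, t_I(ε) = θ_I(ε)a₁, t_V(ε) = θ_V(ε)a₁ and B_r(ε), so the output
families of `B9.Thm313Printed` are β∕ε-DEPENDENT exactly where print's B₀(β), B′₀(ε), B′₀(ε,β) are (Theorem 3.1 p. 397).  Nothing of print asserted
beyond the hypothesis schemas.
[cite: Balaban1985BackgroundPropagators, Thm 3.13 p.426 + Thm 3.12 p.423 + (3.39)–(3.47) pp.397–398 + (3.147)–(3.153) pp.425–426; Balaban1984PropagatorsII, (2.51)–(2.52) p.232 + Lemma 2.1 (2.60)–(2.61) p.234] -/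
theorem thm313Printed_completePairMBCZ (𝔬 : ∀ i, Ops (geo i) (bg i) (X i) (Y i) (Z i) (W i)) (R₀ : I → ℝ) (H₀ : I → Prop)
    (GG : ∀ i, B9.KernelFamily (geo i) (bg i)) (bH : ∀ i, BlockNorm (toB6 (geo i) (R₀ i) (H₀ i)) (W i → ℝ))
    (𝔭 : ∀ i, HolderProbes (geo i) (bg i) (X i) (Y i) (PX i) (PY i))
    (bHX : ∀ i, ℝ → BlockNorm (toB6 (geo i) (R₀ i) (H₀ i)) (X i → ℝ))
    (Dd Dds : ∀ i, (bg i).Cfg → P → Module.End ℝ (X i → ℝ))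
    (bHW : ∀ i, ℝ → BlockNorm (toB6 (geo i) (R₀ i) (H₀ i)) (W i → ℝ))
    (ev : ∀ i, (geo i).Loc → X i → ℝ) (evY : ∀ i, (geo i).Loc → Y i → ℝ) {PL : ∀ i, (geo i).Loc → Prop}
    (Rel : ∀ i, (geo i).Site → (geo i).Site → Prop) [∀ i, DecidableRel (Rel i)] (m mN : ℕ)
    (r Cev CL θ₁ θD θ₂ r₁ B₀ B₂ B₄ δ₀ δK σ c ρ a₁ M₁ ML B₃ δ₃ ρ' α Lc κ₀ : ℝ) (Bh Bi Bq BhD Bx Bd θH θI θV Br : ℝ → ℝ)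
    (Bi2 Bd2 : ℝ → ℝ → ℝ)
    (hθ₁ : 0 ≤ θ₁) (hθD : 0 ≤ θD) (hθH : ∀ β, 0 ≤ β → β < 1 → 0 ≤ θH β) (hθI : ∀ ε, 0 < ε → 0 ≤ θI ε) (hθ₂ : 0 ≤ θ₂)
    (hθV : ∀ ε, 0 < ε → 0 ≤ θV ε) (hr₁ : 0 ≤ r₁) (hB₀ : 0 ≤ B₀) (hB₂ : 0 ≤ B₂)
    (hB₃ : 0 ≤ B₃) (hB₄ : 0 ≤ B₄) (hBr : ∀ ε, 0 < ε → 0 ≤ Br ε) (hσ : 0 ≤ σ) (hρ' : 0 < ρ') (hρ'ρ : ρ' + 3 * σ ≤ ρ) (hρ'ρ₅ : ρ' + 5 * σ ≤ ρ)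
    (hσρ' : 3 * σ < (1 - α) * ρ')
    (hρS : ρ ≤ δ₀) (hρ₃ : ρ ≤ δ₃) (hρδ : ρ + σ ≤ δK) (hc : 0 ≤ c) (ha₁ : 0 < a₁) (hM₁ : 0 < M₁)
    (hα0 : 0 ≤ α) (hBi : ∀ ε, 0 < ε → ε ≤ 1 → 0 ≤ Bi ε) (hBd : ∀ ε, 0 < ε → ε ≤ 1 → 0 ≤ Bd ε)
    (hBi2 : ∀ ε β, 0 < ε → ε ≤ 1 → 0 ≤ β → β < 1 → 0 ≤ Bi2 ε β) (hBd2 : ∀ ε β, 0 < ε → ε ≤ 1 → 0 ≤ β → β < 1 → 0 ≤ Bd2 ε β)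
    (hBh : ∀ β, 0 ≤ β → β < 1 → 0 ≤ Bh β) (hBq : ∀ β, 0 ≤ β → β < 1 → 0 ≤ Bq β) (hBhD : ∀ β, 0 ≤ β → β < 1 → 0 ≤ BhD β)
    (hBx : ∀ β, 0 ≤ β → β < 1 → 0 ≤ Bx β) (hCev : 0 ≤ Cev) (hCL1 : 1 ≤ CL)
    (hgeo : ∀ i, GeoOK (geo i)) (S : ∀ i, ModelSignsOn (geo i) (PL i))
    (hL1 : ∀ i, 1 ≤ (geo i).L) (hLle : ∀ i, (geo i).L ≤ Lc) (hη : ∀ i, 0 < (geo i).eta) (hκ : ∀ i, (bH i).κ ≤ κ₀)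
    (hκW : ∀ (i : I) (ε : ℝ), (bHW i ε).κ ≤ κ₀)
    (hrow : ∀ i, ML ≤ (geo i).M → RowSum (toB6 (geo i) (R₀ i) (H₀ i)) σ c)
    (hL21 : ∀ δ : ℝ, 0 < δ → ∃ ML' c' : ℝ, Lemma21AboveG geo R₀ H₀ δ α ML' c')
    (hnbr : ∀ (i : I) (y : (geo i).Site), (nbr (geo i) r y).card ≤ mN)
    (hCL : ∀ (i : I) (a a' : (geo i).Site), (geo i).dist a a' ≤ r → (geo i).len a ≤ CL * (geo i).len a')
    (hsat : ∀ (i : I) (n : Fin 4) (B' δ' : ℝ),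
      (∀ a a' b, Rel i a a' → maj342 (geo i) n B' δ' a b = maj342 (geo i) n B' δ' a' b) ∧
      (∀ a b b', Rel i b b' → maj342 (geo i) n B' δ' a b = maj342 (geo i) n B' δ' a b'))
    (hmult : ∀ (i : I) (y' : (geo i).Site), (Finset.univ.filter (fun y'' => Rel i y'' y')).card ≤ m)
    (hcoR : ∀ (i : I) (U : (bg i).Cfg),
      CoRealizesRel (GG i) 0 U (Rel i) (𝔬 i).blk (𝔬 i).blk (ev i) ((𝔬 i).GG U) ∧
      CoRealizesRel (GG i) 2 U (Rel i) (𝔬 i).blk (𝔬 i).blkY (evY i) ((𝔬 i).GG U ∘ₗ (𝔬 i).Dstar U))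
    (hco1R : ∀ (i : I) (U : (bg i).Cfg), CoRealizesRel (GG i) 1 U (Rel i) (𝔬 i).blkY (𝔬 i).blk (ev i) ((𝔬 i).D U ∘ₗ (𝔬 i).GG U))
    (hcoG : ∀ (i : I) (U : (bg i).Cfg),
      CoReadsGlob (GG i) 0 U (𝔬 i).blk (𝔬 i).blk (ev i) ((𝔬 i).GG U) ∧
      CoReadsGlob (GG i) 1 U (𝔬 i).blkY (𝔬 i).blk (ev i) ((𝔬 i).D U ∘ₗ (𝔬 i).GG U) ∧
      CoReadsGlob (GG i) 2 U (𝔬 i).blk (𝔬 i).blkY (evY i) ((𝔬 i).GG U ∘ₗ (𝔬 i).Dstar U))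
    (hsymGG : ∀ i, M₁ ≤ (geo i).M → ∀ α₀ : ℝ, 0 < α₀ → (geo i).M * α₀ ≤ a₁ →
      ∀ U : (bg i).Cfg, (bg i).Reg335 c35 α₀ U → (bg i).Reg336 c35 α₀ U →
        IsTransposePair ((𝔬 i).GG U) ((𝔬 i).GG U) ∧ IsTransposePair ((𝔬 i).D U ∘ₗ (𝔬 i).GG U) ((𝔬 i).GG U ∘ₗ (𝔬 i).Dstar U))
    (hl2N : ∀ (i : I) (U : (bg i).Cfg),
      L2ReadsNbr (R := R₀ i) (H := H₀ i) (GG i) 0 U (Rel i) r Cev (𝔬 i).blk (𝔬 i).blk (ev i) ((𝔬 i).GG U) ∧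
      L2ReadsNbr (R := R₀ i) (H := H₀ i) (GG i) 1 U (Rel i) r Cev (𝔬 i).blkY (𝔬 i).blk (ev i) ((𝔬 i).D U ∘ₗ (𝔬 i).GG U) ∧
      L2ReadsNbr (R := R₀ i) (H := H₀ i) (GG i) 2 U (Rel i) r Cev (𝔬 i).blk (𝔬 i).blkY (evY i) ((𝔬 i).GG U ∘ₗ (𝔬 i).Dstar U) ∧
      L2ReadsNbr (R := R₀ i) (H := H₀ i) (GG i) 3 U (Rel i) r Cev ((𝔬 i).blk ∘ Prod.fst) (𝔬 i).blk (ev i)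
        (familyOp (fun q : P × P => Dd i U q.1 ∘ₗ ((𝔬 i).GG U ∘ₗ Dds i U q.2))) ∧
      L2ReadsNbr (R := R₀ i) (H := H₀ i) (GG i) 4 U (Rel i) r Cev ((𝔬 i).blk ∘ Prod.fst) (𝔬 i).blk (ev i)
        (familyOp (fun q : P × P => (Dd i U q.1 ∘ₗ Dd i U q.2) ∘ₗ (𝔬 i).GG U)) ∧
      L2ReadsNbr (R := R₀ i) (H := H₀ i) (GG i) 5 U (Rel i) r Cev ((𝔬 i).blk ∘ Prod.fst) (𝔬 i).blk (ev i)
        (familyOp (fun q : P × P => (𝔬 i).GG U ∘ₗ (Dds i U q.1 ∘ₗ Dds i U q.2))))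
    (hH1N : ∀ (i : I) (U : (bg i).Cfg),
      H1ReadsNbr (GG i) U (𝔭 i) (Rel i) r (𝔬 i).blk (𝔬 i).blkY (ev i) (evY i) ((𝔬 i).D U ∘ₗ (𝔬 i).GG U)
        ((𝔬 i).GG U ∘ₗ (𝔬 i).Dstar U))
    (hIF : ∀ (i : I) (U : (bg i).Cfg),
      InputReadsFam (GG i) U (bHX i) r ((𝔬 i).blk ∘ Prod.fst) ((𝔭 i).blkPX ∘ Prod.fst) (fun β => sliceProbe ((𝔭 i).ΦX U β)) (ev i)
        (familyOp (fun q : P × P => Dd i U q.1 ∘ₗ ((𝔬 i).GG U ∘ₗ Dds i U q.2))))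
    (hRdist : ∀ (i : I) (a a' b : (geo i).Site), Rel i a a' → (geo i).dist a b = (geo i).dist a' b)
    (hmodel : ∀ i, M₁ ≤ (geo i).M → ∀ α₀ : ℝ, 0 < α₀ → (geo i).M * α₀ ≤ a₁ →
      ∀ U : (bg i).Cfg, (bg i).Reg335 c35 α₀ U → (bg i).Reg336 c35 α₀ U →
        Thm33G0 (𝔬 i) (R₀ i) (H₀ i) B₀ δ₀ U ∧
        Step (𝔬 i) (R₀ i) (H₀ i) (hgeo i).lenle 1 (θ₁ * ((geo i).M * α₀)) δK U ∧
        Step (𝔬 i) (R₀ i) (H₀ i) (hgeo i).lenle 2 (θ₁ * ((geo i).M * α₀)) δK U ∧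
        FormSmall (𝔬 i) (r₁ * ((geo i).M * α₀)) U ∧ Identities (𝔬 i) U)
    (hleft : ∀ i, M₁ ≤ (geo i).M → ∀ α₀ : ℝ, 0 < α₀ → (geo i).M * α₀ ≤ a₁ →
      ∀ U : (bg i).Cfg, (bg i).Reg335 c35 α₀ U → (bg i).Reg336 c35 α₀ U →
        LeftStep (𝔬 i) (R₀ i) (H₀ i) (hgeo i).lenle B₀ δ₀ (θD * ((geo i).M * α₀)) δK U)
    (wZ : ∀ i, (geo i).Site → ℝ) (hwZ : ∀ i y, 0 < wZ i y)
    (hletters : ∀ i, M₁ ≤ (geo i).M → ∀ α₀ : ℝ, 0 < α₀ → (geo i).M * α₀ ≤ a₁ →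
      ∀ U : (bg i).Cfg, (bg i).Reg335 c35 α₀ U → (bg i).Reg336 c35 α₀ U →
        Letters313Z (𝔬 i) (R₀ i) (H₀ i) (hgeo i) (wZ i) (hwZ i) B₃ δ₃ U)
    (hlettersD : ∀ i, M₁ ≤ (geo i).M → ∀ α₀ : ℝ, 0 < α₀ → (geo i).M * α₀ ≤ a₁ →
      ∀ U : (bg i).Cfg, (bg i).Reg335 c35 α₀ U → (bg i).Reg336 c35 α₀ U →
        Letters313DZ (𝔬 i) (R₀ i) (H₀ i) (hgeo i) (wZ i) (hwZ i) B₃ δ₃ (bH i) U ∧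
          Letters313DMZ (𝔬 i) (𝔭 i) (Dd i) (R₀ i) (H₀ i) (hgeo i) (wZ i) (hwZ i) B₃ Bq δ₃ (bH i) U)
    (hG0C : ∀ i, M₁ ≤ (geo i).M → ∀ α₀ : ℝ, 0 < α₀ → (geo i).M * α₀ ≤ a₁ →
      ∀ U : (bg i).Cfg, (bg i).Reg335 c35 α₀ U → (bg i).Reg336 c35 α₀ U →
        Thm33G0Dir (𝔬 i) (𝔭 i) (Dd i) (Dds i) (R₀ i) (H₀ i) (bHX i) B₀ Bh Bi Bi2 δ₀ U ∧
          Thm33G0DirR (𝔬 i) (Dds i) (R₀ i) (H₀ i) B₀ δ₀ U)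
    (hstepD : ∀ i, M₁ ≤ (geo i).M → ∀ α₀ : ℝ, 0 < α₀ → (geo i).M * α₀ ≤ a₁ →
      ∀ U : (bg i).Cfg, (bg i).Reg335 c35 α₀ U → (bg i).Reg336 c35 α₀ U →
        StepDirB (𝔬 i) (𝔭 i) (Dd i) (Dds i) (R₀ i) (H₀ i) (bHX i) (hgeo i).lenle (θD * ((geo i).M * α₀))
          (fun β => θH β * ((geo i).M * α₀)) (fun ε => θI ε * ((geo i).M * α₀)) δK U)
    (hLHH : ∀ i, M₁ ≤ (geo i).M → ∀ α₀ : ℝ, 0 < α₀ → (geo i).M * α₀ ≤ a₁ →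
      ∀ U : (bg i).Cfg, (bg i).Reg335 c35 α₀ U → (bg i).Reg336 c35 α₀ U →
        LettersHHZ (𝔬 i) (𝔭 i) (R₀ i) (H₀ i) (hgeo i).lenle
          (weightNorm (BlockNorm.ofBlocks (toB6 (geo i) (R₀ i) (H₀ i)) (𝔬 i).blkZ) (wZ i) fun y => (hwZ i y).le) Bq δ₃ U)
    (hLH3 : ∀ i, M₁ ≤ (geo i).M → ∀ α₀ : ℝ, 0 < α₀ → (geo i).M * α₀ ≤ a₁ →
      ∀ U : (bg i).Cfg, (bg i).Reg335 c35 α₀ U → (bg i).Reg336 c35 α₀ U →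
        Letters313HZ (𝔬 i) (𝔭 i) (R₀ i) (H₀ i) (hgeo i) (wZ i) (hwZ i) (bH i) BhD Bx δ₃ U)
    (hG0L2 : ∀ i, M₁ ≤ (geo i).M → ∀ α₀ : ℝ, 0 < α₀ → (geo i).M * α₀ ≤ a₁ →
      ∀ U : (bg i).Cfg, (bg i).Reg335 c35 α₀ U → (bg i).Reg336 c35 α₀ U →
        Thm33G0L2M (𝔬 i) (Dd i) (Dds i) (R₀ i) (H₀ i) B₂ δ₀ U)
    (hstepL2 : ∀ i, M₁ ≤ (geo i).M → ∀ α₀ : ℝ, 0 < α₀ → (geo i).M * α₀ ≤ a₁ →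
      ∀ U : (bg i).Cfg, (bg i).Reg335 c35 α₀ U → (bg i).Reg336 c35 α₀ U →
        StepL2 (𝔬 i) (R₀ i) (H₀ i) (θ₂ * ((geo i).M * α₀)) δK U)
    (vZ : ∀ i, (geo i).Site → ℝ) (hvZ : ∀ i y, 0 < vZ i y)
    (hLL2 : ∀ i, M₁ ≤ (geo i).M → ∀ α₀ : ℝ, 0 < α₀ → (geo i).M * α₀ ≤ a₁ →
      ∀ U : (bg i).Cfg, (bg i).Reg335 c35 α₀ U → (bg i).Reg336 c35 α₀ U →
        Letters313L2PZ (𝔬 i) (Dd i) (Dds i) (R₀ i) (H₀ i) B₄ δ₃ (vZ i) (hvZ i) U ∧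
          Letters313L2MZ (𝔬 i) (Dd i) (Dds i) (R₀ i) (H₀ i) B₄ δ₃ (vZ i) (hvZ i) U)
    (hLIM : ∀ i, M₁ ≤ (geo i).M → ∀ α₀ : ℝ, 0 < α₀ → (geo i).M * α₀ ≤ a₁ →
      ∀ U : (bg i).Cfg, (bg i).Reg335 c35 α₀ U → (bg i).Reg336 c35 α₀ U →
        Letters313IMBC (𝔬 i) (𝔭 i) (Dd i) (Dds i) (R₀ i) (H₀ i) (hgeo i).lenle (bHX i) (bHW i) Br (fun ε => θV ε * ((geo i).M * α₀))
          Bd Bd2 δ₃ δK (Rel i) U) :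
    B9.Thm313Printed c35 geo bg GG (fun i => HasRWExpOfOps (𝔬 i)) (fun i => PosDefKOfOps (𝔬 i)) := by
  -- thresholds and uniform constants
  obtain ⟨MLg, cg, hLg⟩ := hL21 ρ' hρ'
  set M₁' : ℝ := max (max M₁ ML) MLg with hM₁'
  have hM₁'pos : 0 < M₁' := lt_max_of_lt_left (lt_max_of_lt_left hM₁)
  have hle₁ : ∀ {i : I}, M₁' ≤ (geo i).M → M₁ ≤ (geo i).M := fun h => ((le_max_left _ _).trans (le_max_left _ _)).trans h
  have hleL : ∀ {i : I}, M₁' ≤ (geo i).M → ML ≤ (geo i).M := fun h => ((le_max_right _ _).trans (le_max_left _ _)).trans h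
  have hleg : ∀ {i : I}, M₁' ≤ (geo i).M → MLg ≤ (geo i).M := fun h => (le_max_right _ _).trans h
  have hθc : 0 ≤ θ₁ * c := mul_nonneg hθ₁ hc
  have hB₂c : 0 ≤ B₂ * θ₂ * c * c := mul_nonneg (mul_nonneg (mul_nonneg hB₂ hθ₂) hc) hc
  set a₁' : ℝ := min a₁ (min (2 * (θ₁ * c + 1))⁻¹ (2 * (B₂ * θ₂ * c * c + 1))⁻¹) with ha₁'
  have ha₁'pos : 0 < a₁' := lt_min ha₁ (lt_min (inv_pos.mpr (by linarith)) (inv_pos.mpr (by linarith)))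
  have ha₁'le : a₁' ≤ a₁ := min_le_left _ _
  have hLc1 : ∀ i, 1 ≤ Lc := fun i => (hL1 i).trans (hLle i)
  set Λu : ℝ := Lc ^ (4 : ℝ) with hΛu
  set NP : ℝ := Real.sqrt (Fintype.card (P × P)) with hNP
  have hNP0 : 0 ≤ NP := Real.sqrt_nonneg _
  set C₂ : ℝ := const313 (2 * B₀) (2 * B₃) B₃ c with hC₂
  set CD : ℝ := constD313 (B₀ + θD * a₁ * (2 * B₀) * c) (θD * a₁) (2 * B₀) (2 * B₃) B₃ (max κ₀ 0) c with hCD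
  set Csup : ℝ := max C₂ CD with hCsup
  have hC₂0 : 0 ≤ C₂ := const313_nonneg (by linarith) (by linarith) hB₃ hc
  have hCsup0 : 0 ≤ Csup := hC₂0.trans (le_max_left _ _)
  set KpU : ℝ := (B₂ + B₄) + (B₂ + B₄) * (θ₂ * a₁ * (2 * (B₂ + B₄)) * c) * c with hKpU
  have hS0 : 0 ≤ B₂ + B₄ := add_nonneg hB₂ hB₄
  have hKpU0 : 0 ≤ KpU :=
    add_nonneg hS0 (mul_nonneg (mul_nonneg hS0 (mul_nonneg (mul_nonneg (mul_nonneg hθ₂ ha₁.le) (by linarith)) hc)) hc)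
  set KGu : ℝ := constG46 KpU c with hKGu
  have hKGu0 : 0 ≤ KGu := constG46_nonneg hKpU0 hc
  set K6 : ℝ := (Csup + KGu + NP * KGu) * Λu with hK6
  set ρ₄ : ℝ := (1 - α) * ρ' - 3 * σ with hρ₄def
  have hρ₄pos : 0 < ρ₄ := by rw [hρ₄def]; linarith
  have hρ₄r : ρ₄ + 3 * σ ≤ (1 - α) * ρ' := by rw [hρ₄def]; linarith
  have hρ₄1 : ρ₄ ≤ (1 - α) * ρ' := by linarith
  have hρ₄2 : ρ₄ ≤ ρ' := by
    have h1 : (1 - α) * ρ' = ρ' - α * ρ' := by ring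
    rw [hρ₄def, h1]; linarith [mul_nonneg hα0 hρ'.le]
  have hm00 : (0 : ℝ) ≤ m := Nat.cast_nonneg m
  have hmN0 : (0 : ℝ) ≤ mN := Nat.cast_nonneg mN
  set tH : ℝ → ℝ := fun β => θH β * a₁ with htH
  set tD : ℝ := θD * a₁ with htD
  set tI : ℝ → ℝ := fun ε => θI ε * a₁ with htI
  set tV : ℝ → ℝ := fun ε => θV ε * a₁ with htV
  set κu : ℝ := max κ₀ 1 with hκu
  have h1κ : (1 : ℝ) ≤ κu := le_max_right _ _
  set Cu : ℝ → ℝ := fun β => constH313 (Bh β + tH β * (2 * B₀) * c) (tH β) (2 * B₀) (2 * B₃) B₃ (max (BhD β) (Bx β))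
    (max (Bq β) (Bx β))
    κu c with hCu
  set Bβo : ℝ → ℝ := fun β => max ((m : ℝ) * CL * Real.exp (r * ρ₄) * Cu β) 0 with hBβo
  set Bεo : ℝ → ℝ := fun ε => max (Real.exp (r * ρ₄) * ((Bi ε + (B₀ + tD * (2 * B₀) * c) * Λu * tI ε * c) +
    κu * (Bd ε + (B₀ + tD * (2 * B₀) * c) * Λu * tV ε * c) * Br ε * c +
    (B₃ + tD * (2 * B₃) * c) * Λu * (B₃ * (B₃ * ((m : ℝ) * (2 * B₀)) * c) * c) * c)) 0 with hBεo
  set Bεβo : ℝ → ℝ → ℝ := fun ε β => max (CL * Real.exp (r * ρ₄) *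
    ((Bi2 ε β + (Bh β + max (tH β) (tI (β + ε)) * (2 * B₀) * c) * Λu * max (tH β) (tI (β + ε)) * c) +
    κu * (Bd2 ε β + (Bh β + max (tH β) (tI (β + ε)) * (2 * B₀) * c) * Λu * tV (β + ε) * c) * Br (β + ε) * c +
    (Bq β + max (tH β) (tI (β + ε)) * (2 * B₃) * c) * Λu * (B₃ * (B₃ * ((m : ℝ) * (2 * B₀)) * c) * c) * c)) 0 with hBεβo
  have hBβo0 : ∀ β, 0 ≤ Bβo β := fun β => le_max_right _ _
  have hBεo0 : ∀ ε, 0 ≤ Bεo ε := fun ε => le_max_right _ _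
  have hBεβo0 : ∀ ε β, 0 ≤ Bεβo ε β := fun ε β => le_max_right _ _
  refine thm313Printed_of_stepRelZ 𝔬 R₀ H₀ GG bH ev evY Rel m θ₁ θD r₁ B₀ δ₀ δK σ c ρ a₁' M₁' ML
    ((mN : ℝ) * m * Cev * CL ^ 2 * Real.exp (r * ρ₄) * K6) ρ₄ B₃ δ₃ ρ' α Lc κ₀ Bβo Bεo Bεβo hθ₁ hθD hr₁ hB₀ hB₃ hσ hρ' hρ'ρ hρS hρ₃ hρδ hc
    ha₁'pos hM₁'pos hρ₄pos hBβo0 hBεo0 hBεβo0 hgeo S hL1 hLle hη hκ hrow hL21 hsat hmult hcoR hco1R hcoG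
    (fun i hM α₀ hα₀ hMa U hU hU' => hmodel i (hle₁ hM) α₀ hα₀ (hMa.trans ha₁'le) U hU hU')
    (fun i hM α₀ hα₀ hMa U hU hU' => hleft i (hle₁ hM) α₀ hα₀ (hMa.trans ha₁'le) U hU hU') wZ hwZ
    (fun i hM α₀ hα₀ hMa U hU hU' => hletters i (hle₁ hM) α₀ hα₀ (hMa.trans ha₁'le) U hU hU')
    (fun i hM α₀ hα₀ hMa U hU hU' => (hlettersD i (hle₁ hM) α₀ hα₀ (hMa.trans ha₁'le) U hU hU').1) ?_
  -- the residual, PROVED per member and per configuration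
  intro i hM α₀ hα₀ hMa U hU hU'
  have hM₁i : M₁ ≤ (geo i).M := hle₁ hM
  have hMpos : 0 < (geo i).M := hM₁.trans_le hM₁i
  have hm0 : 0 ≤ (geo i).M * α₀ := (mul_pos hMpos hα₀).le
  have hma₁ : (geo i).M * α₀ ≤ a₁ := hMa.trans ha₁'le
  have hmθ : (geo i).M * α₀ ≤ (2 * (θ₁ * c + 1))⁻¹ := hMa.trans ((min_le_right _ _).trans (min_le_left _ _))
  have hm₂ : (geo i).M * α₀ ≤ (2 * (B₂ * θ₂ * c * c + 1))⁻¹ := hMa.trans ((min_le_right _ _).trans (min_le_right _ _))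
  obtain ⟨h33, hS1, hS2, -, hI⟩ := hmodel i hM₁i α₀ hα₀ hma₁ U hU hU'
  have hLS := hleft i hM₁i α₀ hα₀ hma₁ U hU hU'
  have hL := hletters i hM₁i α₀ hα₀ hma₁ U hU hU'
  obtain ⟨hLD, hLDM⟩ := hlettersD i hM₁i α₀ hα₀ hma₁ U hU hU'
  obtain ⟨hH0, hHR⟩ := hG0C i hM₁i α₀ hα₀ hma₁ U hU hU'
  have hStD := hstepD i hM₁i α₀ hα₀ hma₁ U hU hU'
  have hHH := hLHH i hM₁i α₀ hα₀ hma₁ U hU hU'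
  have hH3 := hLH3 i hM₁i α₀ hα₀ hma₁ U hU hU'
  have hL2 := hG0L2 i hM₁i α₀ hα₀ hma₁ U hU hU'
  have hStL := hstepL2 i hM₁i α₀ hα₀ hma₁ U hU hU'
  obtain ⟨hLt, hLM⟩ := hLL2 i hM₁i α₀ hα₀ hma₁ U hU hU'
  have hLIi := hLIM i hM₁i α₀ hα₀ hma₁ U hU hU'
  obtain ⟨hsymi, htri⟩ := hsymGG i hM₁i α₀ hα₀ hma₁ U hU hU'
  have hrowi := hrow i (hleL hM)
  obtain ⟨h260, -, hsize⟩ := hLg i (hleg hM)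
  obtain ⟨hl0, hl1, hl2, hl3, hl4, hl5⟩ := hl2N i U
  have hH1 := hH1N i U
  have hIn := hIF i U
  have hlen := (hgeo i).lenle
  -- the second-argument saturation of d from the first-argument one and the symmetry of d
  have hRd₂ : ∀ a b b' : (geo i).Site, Rel i b b' → (geo i).dist a b = (geo i).dist a b' := fun a b b' h => by
    rw [(hgeo i).symm a b, (hgeo i).symm a b', hRdist i b b' a h]
  set θ : ℝ := θ₁ * ((geo i).M * α₀) with hθdef
  set θ' : ℝ := θD * ((geo i).M * α₀) with hθ'def
  set θH' : ℝ → ℝ := fun β => θH β * ((geo i).M * α₀) with hθH'def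
  set θI' : ℝ → ℝ := fun ε => θI ε * ((geo i).M * α₀) with hθI'def
  set θ₂' : ℝ := θ₂ * ((geo i).M * α₀) with hθ₂'def
  set θv' : ℝ → ℝ := fun ε => θV ε * ((geo i).M * α₀) with hθv'def
  have hθ : 0 ≤ θ := mul_nonneg hθ₁ hm0
  have hθ' : 0 ≤ θ' := mul_nonneg hθD hm0
  have hθH' : ∀ β, 0 ≤ β → β < 1 → 0 ≤ θH' β := fun β h0 h1 => mul_nonneg (hθH β h0 h1) hm0
  have hθI' : ∀ ε, 0 < ε → 0 ≤ θI' ε := fun ε hε => mul_nonneg (hθI ε hε) hm0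
  have hθ₂' : 0 ≤ θ₂' := mul_nonneg hθ₂ hm0
  have hθv' : ∀ ε, 0 < ε → 0 ≤ θv' ε := fun ε hε => mul_nonneg (hθV ε hε) hm0
  have hθ'le : θ' ≤ tD := mul_le_mul_of_nonneg_left hma₁ hθD
  have hθH'le : ∀ β, 0 ≤ β → β < 1 → θH' β ≤ tH β := fun β h0 h1 => mul_le_mul_of_nonneg_left hma₁ (hθH β h0 h1)
  have hθI'le : ∀ ε, 0 < ε → θI' ε ≤ tI ε := fun ε hε => mul_le_mul_of_nonneg_left hma₁ (hθI ε hε)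
  have hθ₂'le : θ₂' ≤ θ₂ * a₁ := mul_le_mul_of_nonneg_left hma₁ hθ₂
  have hθv'le : ∀ ε, 0 < ε → θv' ε ≤ tV ε := fun ε hε => mul_le_mul_of_nonneg_left hma₁ (hθV ε hε)
  have hq : θ * c ≤ 1 / 2 := by
    have h := small_aux_mbz hθc hmθ
    calc θ * c = θ₁ * c * ((geo i).M * α₀) := by rw [hθdef]; ring
      _ ≤ 1 / 2 := h
  have hq1 : θ * c < 1 := lt_one_of_le_half hq
  have hq₂ : B₂ * θ₂' * c * c ≤ 1 / 2 := by
    have h := small_aux_mbz hB₂c hm₂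
    calc B₂ * θ₂' * c * c = B₂ * θ₂ * c * c * ((geo i).M * α₀) := by rw [hθ₂'def]; ring
      _ ≤ 1 / 2 := h
  have hq₂1 : B₂ * θ₂' * c * c < 1 := lt_one_of_le_half hq₂
  have hinv0 : 0 ≤ (1 - θ * c)⁻¹ := inv_nonneg.mpr (sub_nonneg.mpr hq1.le)
  have hA₁ : 0 ≤ B₀ * (1 - θ * c)⁻¹ := mul_nonneg hB₀ hinv0
  have hA₃ : 0 ≤ B₃ * (1 - θ * c)⁻¹ := mul_nonneg hB₃ hinv0
  have hA₁le : B₀ * (1 - θ * c)⁻¹ ≤ 2 * B₀ := const_le_two_mul hB₀ hq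
  have hA₃le : B₃ * (1 - θ * c)⁻¹ ≤ 2 * B₃ := const_le_two_mul hB₃ hq
  -- rates
  have hρ'0 : ρ' ≤ δ₀ := by linarith
  have hρ'₃ : ρ' ≤ δ₃ := by linarith
  have hρ'K : ρ' + σ ≤ δK := by linarith
  have hρK : ρ ≤ δK := by linarith
  -- the sup-class constants below Csup
  have hCle : const313 (B₀ * (1 - θ * c)⁻¹) (B₃ * (1 - θ * c)⁻¹) B₃ c ≤ Csup :=
    (const313_mono hA₁ hA₁le hA₃ hA₃le hB₃ hc).trans (le_max_left _ _)
  have hCLle : B₀ + θ' * (B₀ * (1 - θ * c)⁻¹) * c ≤ B₀ + θD * a₁ * (2 * B₀) * c := by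
    have h2 : θ' * (B₀ * (1 - θ * c)⁻¹) ≤ θD * a₁ * (2 * B₀) := mul_le_mul hθ'le hA₁le hA₁ (mul_nonneg hθD ha₁.le)
    have h3 : θ' * (B₀ * (1 - θ * c)⁻¹) * c ≤ θD * a₁ * (2 * B₀) * c := mul_le_mul_of_nonneg_right h2 hc
    linarith
  have hDle : constD313 (B₀ + θ' * (B₀ * (1 - θ * c)⁻¹) * c) θ' (B₀ * (1 - θ * c)⁻¹) (B₃ * (1 - θ * c)⁻¹) B₃ (bH i).κ c ≤
      Csup :=
    (constD313_mono hCLle hθ' hθ'le hA₁ hA₁le hA₃ hA₃le hB₃ ((hκ i).trans (le_max_left _ _)) hc).trans (le_max_right _ _)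
  -- the L²-class constants below KGu and K₆
  have hKp0 : 0 ≤ constKp B₂ B₄ θ₂' c := (constP_nonneg_le hθ₂' hc hq₂1 hS0 hS0 hS0 le_rfl le_rfl le_rfl).1
  have hKGle : constG46 (constKp B₂ B₄ θ₂' c) c ≤ KGu := constG46_mono hKp0 (constKp_le hB₂ hB₄ hθ₂' hθ₂'le hc hq₂) hc
  have hL0i : 0 < (geo i).L := lt_of_lt_of_le one_pos (hL1 i)
  have hL4 : (geo i).L ^ (4 : ℝ) ≤ Λu := Real.rpow_le_rpow hL0i.le (hLle i) (by norm_num)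
  have h1Λu : 1 ≤ Λu := by rw [hΛu]; exact Real.one_le_rpow (hLc1 i) (by norm_num)
  have hΛu0 : 0 ≤ Λu := zero_le_one.trans h1Λu
  have hK60 : 0 ≤ K6 := mul_nonneg (add_nonneg (add_nonneg hCsup0 hKGu0) (mul_nonneg hNP0 hKGu0)) hΛu0
  have hK6a : Csup * Λu ≤ K6 := by
    have h0 : 0 ≤ (KGu + NP * KGu) * Λu := mul_nonneg (add_nonneg hKGu0 (mul_nonneg hNP0 hKGu0)) hΛu0
    calc Csup * Λu ≤ Csup * Λu + (KGu + NP * KGu) * Λu := le_add_of_nonneg_right h0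
      _ = K6 := by rw [hK6]; ring
  have hK6c : NP * (KGu * Λu) ≤ K6 := by
    have h0 : 0 ≤ (Csup + KGu) * Λu := mul_nonneg (add_nonneg hCsup0 hKGu0) hΛu0
    calc NP * (KGu * Λu) ≤ NP * (KGu * Λu) + (Csup + KGu) * Λu := le_add_of_nonneg_right h0
      _ = K6 := by rw [hK6]; ring
  have hK6b : KGu ≤ K6 := by
    have h1 : KGu ≤ KGu * Λu := le_mul_of_one_le_right hKGu0 h1Λu
    have h0 : 0 ≤ (Csup + NP * KGu) * Λu := mul_nonneg (add_nonneg hCsup0 (mul_nonneg hNP0 hKGu0)) hΛu0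
    have h2 : KGu * Λu ≤ K6 :=
      calc KGu * Λu ≤ KGu * Λu + (Csup + NP * KGu) * Λu := le_add_of_nonneg_right h0
        _ = K6 := by rw [hK6]; ring
    exact h1.trans h2
  -- the scale transfers of p. 398 at (ρ′, α) and the uniform bound of their constants
  have hST : ∀ γ : ℝ, |γ| ≤ 4 → ScaleTransfer (geo i) ρ' α ((geo i).L ^ |γ|) (fun y => (geo i).len y ^ γ) ∧
      0 ≤ (geo i).L ^ |γ| ∧ (geo i).L ^ |γ| ≤ Λu := fun γ hγ =>
    ⟨scaleTransfer_rpow_of_260 h260 hsize (hL1 i) (hη i) γ hγ, Real.rpow_nonneg hL0i.le _,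
      (B9Ineq347AllEntries.size_condition_compact (geo i).L γ _ (hL1 i) hγ hsize).2.trans hL4⟩
  obtain ⟨hST1, hΛ₁0, hΛ₁le⟩ := hST 1 (by norm_num)
  obtain ⟨hSTh, -, hΛhle⟩ := hST (1 / 2) (by rw [abs_of_nonneg (by norm_num : (0 : ℝ) ≤ 1 / 2)]; norm_num)
  obtain ⟨hSTm, hΛm0, hΛmle⟩ := hST (-1) (by norm_num)
  -- the L² schemas at the common rate ρ
  have hexpK : ∀ y y' : (geo i).Site, Real.exp (-(δK * (geo i).dist y y')) ≤ Real.exp (-(ρ * (geo i).dist y y')) := fun y y' =>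
    Real.exp_le_exp.mpr (neg_le_neg (mul_le_mul_of_nonneg_right hρK ((hgeo i).dnn y y')))
  have hL2ρ : Thm33G0L2M (𝔬 i) (Dd i) (Dds i) (R₀ i) (H₀ i) B₂ ρ U := thm33G0L2M_mono (hgeo i) hB₂ hρS hL2
  have hTρ : BlockBd (g := toB6 (geo i) (R₀ i) (H₀ i)) (𝔬 i).blk (𝔬 i).blk ((𝔬 i).Tpi U + (𝔬 i).T2 U)
      (fun (y y' : (geo i).Site) => θ₂' * ((geo i).len y)⁻¹ * ((geo i).len y')⁻¹ * Real.exp (-(ρ * (geo i).dist y y'))) :=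
    hStL.t1.mono fun y y' => mul_le_mul_of_nonneg_left (hexpK y y')
      (mul_nonneg (mul_nonneg hθ₂' (inv_nonneg.mpr (hlen y))) (inv_nonneg.mpr (hlen y')))
  have hLtρ : Letters313L2PZ (𝔬 i) (Dd i) (Dds i) (R₀ i) (H₀ i) B₄ ρ (vZ i) (hvZ i) U := letters313L2PZ_mono (hgeo i) hB₄ hρ₃ hLt
  have hLMρ : Letters313L2MZ (𝔬 i) (Dd i) (Dds i) (R₀ i) (H₀ i) B₄ ρ (vZ i) (hvZ i) U := letters313L2MZ_mono (hgeo i) hB₄ hρ₃ hLM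
  -- the L² block of 𝔊, proved (the mixed member on the pair family)
  have hl2B := GG_l2Block_pairMZ (hgeo i) (Rel i) (ev i) (evY i) hrowi hc hθ hθ' hθ₂' hB₀ hB₂ hB₃ hB₄ hσ hρ' hρ'ρ hρ'ρ₅ hρS hρ₃ hρδ
    hq1 hq₂1 hρ₄pos.le hρ₄1 hρ₄2 hST1 hSTh hSTm hΛ₁0 hΛ₁le hΛhle hΛm0 hΛmle h1Λu hCsup0 hCle hDle hKGu0 hKGle hK60 hK6a hK6b hK6c
    hS1.step1 hS2.step1 h33.e0 h33.e2 hLS hL hLD hI hL2ρ hTρ hLtρ hLMρ hsymi htri hRd₂ (hmult i) (hnbr i) hCL1 (hCL i) hCev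
    hl0 hl1 hl2 hl3 hl4 hl5
  -- the Hölder block of 𝔊, proved
  have hκi : (bH i).κ ≤ κu := (hκ i).trans (le_max_left _ _)
  have hκWi : ∀ ε, (bHW i ε).κ ≤ κu := fun ε => (hκW i ε).trans (le_max_left _ _)
  have hHo := GG_holder_pairMBCZ (hgeo i) (𝔭 i) (GG i) (Rel i) hrowi hc hθ hθ' hθH' hθI' hθv' hθ'le hθH'le hθI'le hθv'le hB₀ hB₃ hBr
    hq hBh hBi hBq
    hBd hBi2 hBd2 hBhD hBx hΛ₁0 hΛ₁le hκi hκWi h1κ hα0 hσ hρ' hρ'ρ hρ₄pos.le hρ₄r hρS hρ₃ hρδ hρ'0 hρ'₃ hρ'K hST1 h33.e0 h33.e2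
    hS1.step1 hS2.step1 hH0 hHR hStD hHH hH3 hL hLD hLDM hLIi hI hRd₂ (hmult i) hCL1 (hCL i) hH1 hIn
  have hβo : ∀ β, 0 ≤ β → β < 1 → (m : ℝ) * CL * Real.exp (r * ρ₄) * Cu β ≤ Bβo β ∧ 0 ≤ Bβo β := fun β _ _ =>
    ⟨le_max_left _ _, hBβo0 β⟩
  have hεo : ∀ ε, 0 < ε → ε ≤ 1 →
      Real.exp (r * ρ₄) * ((Bi ε + (B₀ + tD * (2 * B₀) * c) * Λu * tI ε * c) +
        κu * (Bd ε + (B₀ + tD * (2 * B₀) * c) * Λu * tV ε * c) * Br ε * c +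
        (B₃ + tD * (2 * B₃) * c) * Λu * (B₃ * (B₃ * ((m : ℝ) * (2 * B₀)) * c) * c) * c) ≤ Bεo ε ∧ 0 ≤ Bεo ε := fun ε _ _ =>
    ⟨le_max_left _ _, hBεo0 ε⟩
  have hεβo : ∀ ε β, 0 < ε → ε ≤ 1 → 0 ≤ β → β < 1 →
      CL * Real.exp (r * ρ₄) *
        ((Bi2 ε β + (Bh β + max (tH β) (tI (β + ε)) * (2 * B₀) * c) * Λu * max (tH β) (tI (β + ε)) * c) +
        κu * (Bd2 ε β + (Bh β + max (tH β) (tI (β + ε)) * (2 * B₀) * c) * Λu * tV (β + ε) * c) * Br (β + ε) * c +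
        (Bq β + max (tH β) (tI (β + ε)) * (2 * B₃) * c) * Λu * (B₃ * (B₃ * ((m : ℝ) * (2 * B₀)) * c) * c) * c) ≤ Bεβo ε β ∧ 0 ≤ Bεβo ε β :=
      fun ε β _ _ _ _ =>
    ⟨le_max_left _ _, hBεβo0 ε β⟩
  exact ⟨hl2B, ineq343_345_mono_on (S i) hHo (hgeo i).lenpos hβo hεo hεβo le_rfl⟩

end Family

end

end Literature.MathematicalPhysics.QuantumFieldTheory.Balaban1983to89.B9Thm313WholeLeafCompletePairMBCZ
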